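import Mathlib
import Summits.Ventures.PercRepro2.Defs
import Summits.Ventures.PercRepro2.Independence
import Summits.Ventures.PercRepro2.Graph
import Summits.Ventures.PercRepro2.Induced
import Summits.Ventures.PercRepro2.DisagreementSum
import Summits.Ventures.PercRepro2.DisagreementPinned
import Summits.Ventures.PercRepro2.HullDefs
import Summits.Ventures.PercRepro2.SwitchDefs

/-!
# The total switching map `P → M1` (blind cell PercRepro2, typer-1; mine-2 g8
`proofs/MINE2-SWITCHING.md` §3 THEOREM, lead g10 ask 2026-08-23T07:02:33Z)

For `ζ ∈ PlusSet` (the `+1` configurations of (BASE)) and `ζ′ = switchMap ζ = flip_{R⁺}(ζ)`: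

* `cluster_blue_switch_eq`: `BH(ζ′) = BH ∪ R⁺` (with `SwitchDefs`: (a));
* `cluster_switch_h_subset`: `RH(ζ′) ⊆ BH ∖ RL` (b), hence `h ∉ RL(ζ′)`;
* `l_notMem_cluster_blue_switch`: `l ∉ BH(ζ′)` (c), i.e. `h ∉ BL(ζ′)`;
* `cluster_blue_switch_l_subset`: `BL(ζ′) ⊆ BL ∖ R⁺` (e), hence `o ∉ BL(ζ′)`;
* `RH_subset_BH_union_Rplus`: `RH ⊆ BH ∪ R⁺`, hence `b ∈ BH(ζ′) ∖ RH(ζ′)` (f);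
* **`minusSet_switchMap`**: `PlusSet ζ → MinusSet (switchMap ζ)` — the THEOREM (total switching map).
-/

namespace Summit.Ventures.PercRepro2

namespace Switch

open Hull

variable {V : Type*} {E : Type*} [DecidableEq E] {ends : E → Sym2 V} {G : Finset E} {ζ : Config E}
  {l h : V}

/-! ## Colour bookkeeping of the switched colouring -/

/-- A red edge of `ζ′` is either a flipped blue edge (touching `R⁺`) or an unflipped red edge. -/
lemma red_switch_cases {e : E} (he : switchMap ends G ζ l h e = true) :
    (e ∈ G ∧ e ∈ touches ends (Rplus ends G ζ l h) ∧ ζ e = false) ∨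
      (¬ (e ∈ G ∧ e ∈ touches ends (Rplus ends G ζ l h)) ∧ ζ e = true) := by
  by_cases hf : e ∈ G ∧ e ∈ touches ends (Rplus ends G ζ l h)
  · left
    unfold switchMap at he
    rw [freeFlip_apply_of_mem hf.1 hf.2] at he
    exact ⟨hf.1, hf.2, by simpa using he⟩
  · right
    unfold switchMap at he
    rw [freeFlip_apply_of_not hf] at he
    exact ⟨hf, he⟩

/-- A blue edge of `ζ′` is either a flipped red edge (touching `R⁺`) or an unflipped blue edge. -/
lemma blue_switch_cases {e : E} (he : flipOn G (switchMap ends G ζ l h) e = true) :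
    (e ∈ G ∧ e ∈ touches ends (Rplus ends G ζ l h) ∧ ζ e = true) ∨
      (¬ (e ∈ G ∧ e ∈ touches ends (Rplus ends G ζ l h)) ∧ flipOn G ζ e = true) := by
  by_cases hf : e ∈ G ∧ e ∈ touches ends (Rplus ends G ζ l h)
  · left
    unfold switchMap at he
    rw [flipOn_freeFlip_apply_of_mem hf.1 hf.2] at he
    exact ⟨hf.1, hf.2, he⟩
  · right
    unfold switchMap at he
    rw [flipOn_freeFlip_apply_of_not hf] at he
    exact ⟨hf, he⟩

/-- An unflipped edge touching `R⁺` is pinned, hence red iff blue. -/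
lemma red_of_blue_of_not_flipped {e : E} (hf : ¬ (e ∈ G ∧ e ∈ touches ends (Rplus ends G ζ l h)))
    (ht : e ∈ touches ends (Rplus ends G ζ l h)) (he : flipOn G ζ e = true) : ζ e = true := by
  have hG : e ∉ G := fun hG => hf ⟨hG, ht⟩
  rw [flipOn_of_notMem G ζ hG] at he
  exact he

/-! ## The clusters of `h` after the switch -/

/-- `BH(ζ′) ⊆ BH ∪ R⁺`. -/
theorem cluster_blue_switch_subset :
    cluster ends (flipOn G (switchMap ends G ζ l h)) h ⊆
      cluster ends (flipOn G ζ) h ∪ Rplus ends G ζ l h := by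
  intro u hu
  refine mem_of_conn_of_closed (ends := ends) (ω := flipOn G (switchMap ends G ζ l h)) ?_
    (Or.inl (mem_cluster_self _ _ _)) hu
  intro x hx y hxy
  obtain ⟨_, e, he, hends⟩ := exists_edge_of_adj hxy
  rcases blue_switch_cases he with ⟨_, ht, heR⟩ | ⟨hf, heB⟩
  · rcases hx with hxB | hxP
    · rcases (mem_touches_iff_of_ends hends).1 ht with hxP | hyP
      · exact absurd hxB (notMem_BH_of_mem_Rplus hxP)
      · exact Or.inr hyP
    · exact (mem_Rplus_or_BH_of_red_edge hxP heR hends).symm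
  · rcases hx with hxB | hxP
    · exact Or.inl (mem_BH_of_blue_edge hxB heB hends)
    · have ht : e ∈ touches ends (Rplus ends G ζ l h) := mem_touches_of_ends hends (Or.inl hxP)
      exact (mem_Rplus_or_BH_of_red_edge hxP (red_of_blue_of_not_flipped hf ht heB) hends).symm

/-- (a) `BH(ζ′) = BH ∪ R⁺`. -/
theorem cluster_blue_switch_eq :
    cluster ends (flipOn G (switchMap ends G ζ l h)) h =
      cluster ends (flipOn G ζ) h ∪ Rplus ends G ζ l h :=
  Set.Subset.antisymm cluster_blue_switch_subset
    (Set.union_subset cluster_blue_subset_switch Rplus_subset_cluster_blue_switch)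

/-- (b) `RH(ζ′) ⊆ BH ∖ RL` when `h ∉ RL`. -/
theorem cluster_switch_h_subset (hQ : h ∉ cluster ends ζ l) :
    cluster ends (switchMap ends G ζ l h) h ⊆ cluster ends (flipOn G ζ) h \ cluster ends ζ l := by
  intro u hu
  refine mem_of_conn_of_closed (ends := ends) (ω := switchMap ends G ζ l h) ?_
    ⟨mem_cluster_self _ _ _, hQ⟩ hu
  intro x hx y hxy
  obtain ⟨_, e, he, hends⟩ := exists_edge_of_adj hxy
  rcases red_switch_cases he with ⟨hG, ht, heB⟩ | ⟨hf, heR⟩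
  · exfalso
    have hyB : y ∈ cluster ends (flipOn G ζ) h :=
      mem_BH_of_blue_edge hx.1 (by rw [flipOn_of_mem G ζ hG, heB]; rfl) hends
    rcases (mem_touches_iff_of_ends hends).1 ht with hxP | hyP
    · exact notMem_BH_of_mem_Rplus hxP hx.1
    · exact notMem_BH_of_mem_Rplus hyP hyB
  · have hyR : y ∉ cluster ends ζ l := fun hyR =>
      hx.2 (mem_RL_of_red_edge hyR heR (ends_swap hends))
    by_cases hyK : y ∈ kept ends G ζ l h
    · rcases hyK with hyRL | hyB
      · exact absurd hyRL hyR
      · exact ⟨hyB, hyR⟩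
    · exfalso
      have hyP : y ∈ Rplus ends G ζ l h := mem_Rplus_of_red_edge_BH hx.1 hyK heR hends
      have ht : e ∈ touches ends (Rplus ends G ζ l h) := mem_touches_of_ends hends (Or.inr hyP)
      have hG : e ∉ G := fun hG => hf ⟨hG, ht⟩
      exact hyK (Or.inr (mem_BH_of_blue_edge hx.1 (flipOn_of_notMem_of_eq_true hG heR) hends))

/-- (c) `l ∉ BH(ζ′)` when `l ∈ RL` and `h ∉ BL`. -/
theorem l_notMem_cluster_blue_switch (hQ : h ∉ cluster ends (flipOn G ζ) l) :
    l ∉ cluster ends (flipOn G (switchMap ends G ζ l h)) h := by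
  rw [cluster_blue_switch_eq]
  rintro (hB | hP)
  · exact hQ (conn_symm hB)
  · exact notMem_RL_of_mem_Rplus hP (mem_cluster_self _ _ _)

/-! ## The blue cluster of `l` after the switch -/

/-- (e) `BL(ζ′) ⊆ BL ∖ R⁺` when `h ∉ BL`. -/
theorem cluster_blue_switch_l_subset (hQ : h ∉ cluster ends (flipOn G ζ) l) :
    cluster ends (flipOn G (switchMap ends G ζ l h)) l ⊆
      cluster ends (flipOn G ζ) l \ Rplus ends G ζ l h := by
  -- a vertex of `BL` is never in `BH`
  have hBLBH : ∀ x, x ∈ cluster ends (flipOn G ζ) l → x ∉ cluster ends (flipOn G ζ) h :=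
    fun x hxL hxH => hQ (conn_trans hxL (conn_symm hxH))
  intro u hu
  refine mem_of_conn_of_closed (ends := ends) (ω := flipOn G (switchMap ends G ζ l h)) ?_
    ⟨mem_cluster_self _ _ _, fun hP => notMem_RL_of_mem_Rplus hP (mem_cluster_self _ _ _)⟩ hu
  intro x hx y hxy
  obtain ⟨_, e, he, hends⟩ := exists_edge_of_adj hxy
  rcases blue_switch_cases he with ⟨_, ht, heR⟩ | ⟨hf, heB⟩
  · exfalso
    -- a flipped edge at `x ∈ BL ∖ R⁺` goes into `R⁺`; the red edge `(y, x)` then puts `x` in `R⁺ ∪ BH`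
    have hyP : y ∈ Rplus ends G ζ l h := by
      rcases (mem_touches_iff_of_ends hends).1 ht with hxP | hyP
      · exact absurd hxP hx.2
      · exact hyP
    rcases mem_Rplus_or_BH_of_red_edge hyP heR (ends_swap hends) with hxP | hxB
    · exact hx.2 hxP
    · exact hBLBH x hx.1 hxB
  · have hyL : y ∈ cluster ends (flipOn G ζ) l := mem_cluster_of_edge hx.1 heB hends
    refine ⟨hyL, fun hyP => ?_⟩
    have ht : e ∈ touches ends (Rplus ends G ζ l h) := mem_touches_of_ends hends (Or.inr hyP)
    have heR : ζ e = true := red_of_blue_of_not_flipped hf ht heB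
    rcases mem_Rplus_or_BH_of_red_edge hyP heR (ends_swap hends) with hxP | hxB
    · exact hx.2 hxP
    · exact hBLBH x hx.1 hxB

/-! ## The red cluster of `h` before the switch -/

/-- `RH ⊆ BH ∪ R⁺` when `h ∉ RL`. -/
theorem RH_subset_BH_union_Rplus (hQ : h ∉ cluster ends ζ l) :
    cluster ends ζ h ⊆ cluster ends (flipOn G ζ) h ∪ Rplus ends G ζ l h := by
  intro u hu
  have key : u ∈ (cluster ends (flipOn G ζ) h ∪ Rplus ends G ζ l h) ∩ cluster ends ζ h := by
    refine mem_of_conn_of_closed (ends := ends) (ω := ζ) ?_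
      ⟨Or.inl (mem_cluster_self _ _ _), mem_cluster_self _ _ _⟩ hu
    intro x hx y hxy
    obtain ⟨_, e, he, hends⟩ := exists_edge_of_adj hxy
    have hyH : y ∈ cluster ends ζ h := mem_cluster_of_edge hx.2 he hends
    refine ⟨?_, hyH⟩
    rcases hx.1 with hxB | hxP
    · by_cases hyK : y ∈ kept ends G ζ l h
      · rcases hyK with hyR | hyB
        · exact absurd (conn_trans hyR (conn_symm hyH)) hQ
        · exact Or.inl hyB
      · exact Or.inr (mem_Rplus_of_red_edge_BH hxB hyK he hends)
    · exact (mem_Rplus_or_BH_of_red_edge hxP he hends).symm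
  exact key.1

/-! ## The theorem -/

/-- **THEOREM (total switching map, MINE2-SWITCHING §3)**: `ζ ∈ P` gives `flip_{R⁺}(ζ) ∈ M1`. -/
theorem minusSet_switchMap {o b : V} (hP : PlusSet ends G ζ l h o b) :
    MinusSet ends G (switchMap ends G ζ l h) l h o b := by
  obtain ⟨⟨hQR, hQB⟩, ⟨hoR, hoB⟩, ⟨hbR, hbB⟩⟩ := hP
  refine ⟨⟨?_, ?_⟩, ⟨cluster_subset_switch hoR, fun hoB' => ?_⟩, ⟨?_, ?_⟩⟩
  · -- `h ∉ RL(ζ′)`: `l ∉ RH(ζ′) ⊆ BH ∖ RL`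
    intro hh
    have hl : l ∈ cluster ends (switchMap ends G ζ l h) h := conn_symm hh
    exact ((cluster_switch_h_subset hQR) hl).2 (mem_cluster_self _ _ _)
  · -- `h ∉ BL(ζ′)`: `l ∉ BH(ζ′)`
    intro hh
    exact l_notMem_cluster_blue_switch hQB (conn_symm hh)
  · -- `o ∉ BL(ζ′) ⊆ BL`
    exact hoB ((cluster_blue_switch_l_subset hQB) hoB').1
  · -- `b ∈ BH(ζ′) = BH ∪ R⁺`
    rw [cluster_blue_switch_eq]
    rcases RH_subset_BH_union_Rplus hQR hbR with hbB' | hbP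
    · exact absurd hbB' hbB
    · exact Or.inr hbP
  · -- `b ∉ RH(ζ′) ⊆ BH`
    intro hb
    exact hbB ((cluster_switch_h_subset hQR) hb).1

end Switch

end Summit.Ventures.PercRepro2
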